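import Summits.HubbardSuperconductivity.HubbardSuperconductivity.Theses.DeformationLadder
import Summits.HubbardSuperconductivity.HubbardSuperconductivity.Theorems.TwTipContinuation.Negative.SeededChords

/-!
# HubbardSuperconductivity / DeformationLadder — `PenalisedGroundStateExists`

Route `DeformationLadder`, support item `stmt-HubbardSuperconductivity-14307`: for every side `L ≥ 1`,
coupling `U`, real coefficient `c` and `n ≤ L²`, the penalised pure model
`hubbardTorus 2 L 1 U + c·(pFᴴ pF)` (`pF = pairField dWaveFormFactor L`) has a unit-norm ground state
in the joint sector `(N, S^z) = (2n, 0)`.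

Proof: the penalised matrix is the seeded Hamiltonian
`hubbardTorus 2 L 1 U − (g/L²)·(pFᴴ pF)` of `Theorems/TwTipContinuation/Negative/SeededChords.lean` at
the seed `g := -(c·L²)` (`penalised_eq_seeded`, using `L ≠ 0`), whose normalised sector ground states
exist in every sector `(2n, 0)` with `n ≤ |Λ_L| = L²`
(`TwTipContinuation.Negative.exists_unit_groundState`, finite-dimensional spectral theory on the
`(N↑,N↓) = (n,n)` coordinate block of a Hermitian, sector-preserving matrix).

Sources: E. H. Lieb, PRL 62 (1989) 1201, proof of Thm 1 (sector ground states);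
H. Tasaki, *Physics and Mathematics of Quantum Many-Body Systems* (2020) §2.2.
-/

noncomputable section

namespace Summit.HubbardSuperconductivity.DeformationLadder

open Matrix
open Literature.MathematicalPhysics.QuantumLattice

/-- The penalised Hamiltonian `H + c·P_L` is the seeded Hamiltonian `H − (g/L²)·P_L` at the seed
`g = -(c·L²)` (`L ≥ 1`). [folklore] -/
theorem penalised_eq_seeded (L : ℕ) [NeZero L] (U c : ℝ) :
    hubbardTorus 2 L 1 U + ((c : ℝ) : ℂ) • ((pairField dWaveFormFactor L)ᴴ * pairField dWaveFormFactor L) =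
      hubbardTorus 2 L 1 U - ((-(c * (L : ℝ) ^ 2) / (L : ℝ) ^ 2 : ℝ) : ℂ) •
        ((pairField dWaveFormFactor L)ᴴ * pairField dWaveFormFactor L) := by
  have hL : ((L : ℝ) ^ 2) ≠ 0 := pow_ne_zero 2 (Nat.cast_ne_zero.mpr (NeZero.ne L))
  have h : (-(c * (L : ℝ) ^ 2) / (L : ℝ) ^ 2 : ℝ) = -c := by
    rw [neg_div, mul_div_assoc, div_self hL, mul_one]
  rw [h, Complex.ofReal_neg, neg_smul, sub_neg_eq_add]

/-- **Normalised sector ground states of the penalised pure model exist** (route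
`DeformationLadder`, item `stmt-HubbardSuperconductivity-14307`): for every side `L ≥ 1`, coupling
`U`, real `c` and `n ≤ L²`, the matrix `hubbardTorus 2 L 1 U + c·(pFᴴ pF)` has a unit vector which is
a ground state in the joint sector `(N, S^z) = (2n, 0)`. Finite-dimensional spectral theory in the
`(n,n)` coordinate sector of a Hermitian, `(N↑,N↓)`-block-diagonal matrix, then normalisation.
Lieb, PRL 62 (1989) 1201, proof of Thm 1; Tasaki (2020) §2.2. [folklore] -/
theorem penalisedGroundStateExists_proof :
    Summit.HubbardSuperconductivity.HubbardSuperconductivity.Theses.DeformationLadder.PenalisedGroundStateExists := by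
  intro L _ U c n hn
  have hcard : n ≤ Fintype.card (FermionTorus 2 L) := by
    rwa [Summit.HubbardSuperconductivity.NoGo.card_fermionTorus_two]
  obtain ⟨ψ, hψ1, hψ⟩ :=
    Summit.HubbardSuperconductivity.TwTipContinuation.Negative.exists_unit_groundState U
      (-(c * (L : ℝ) ^ 2)) L hcard
  refine ⟨ψ, hψ1, ?_⟩
  rw [penalised_eq_seeded]
  exact hψ

end Summit.HubbardSuperconductivity.DeformationLadder
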